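import Summits.Ventures.QEC.Census.CertInfoSetSound
import HarnessLib

/-!
# Exact-rank certificates by reduced row-echelon words (no parity table)

Venture QEC (cell `qec`), checker plumbing for the `k` column of large codes. The rank certificate `RC(H)` of
plan/CERT-FORMAT.md v1 §3 (`Census/RankCert.lean`, type-02) verifies an `r × r` parity table
`|H[pivot a] ∩ M_i| ≡ [a = i]`, each entry a structural `popc` over `n` bits: `r² · n` kernel steps, which at
`n = 288` already needs four files (`Census/BB/BB288Rank*.lean`) and at `n = 360`, `756` is out of budget.
This file certifies the SAME conclusion `rank (rowMatrix n H) = r` from the reduced row-echelon form of `H`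
instead, with GMP-backed word operations only (`^^^`, `testBit`), `O(r · |H|)` of them:

* DATA: the claimed rank `r`, the pivot columns `piv` (`r` qubit indices), the reduced rows `red` (`r` words over the
  `n` columns, unit pivot columns), and `masks` (`r` numerals over the ROWS of `H`: bit `i` of `masks[a]` set = row
  `H[i]` enters the XOR producing `red[a]`);
* CHECK `rankRREFOK n H r piv red masks`: `|piv| = r`; `pivotsOK n piv red` (search-7's `Census/CertInfoSet.lean`:
  `|piv| = |red|`, pivots `< n`, column `piv[i]` of the reduced rows is the unit vector `e_i`); `|masks| = |red|` and
  `xorMask H masks[a] = red[a]` for every `a` (so every reduced row lies in the row space of `H`); and every row `h` of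
  `H` equals `redSel piv red h`, the XOR of the reduced rows whose pivot bit is set in `h` (so every row of `H` lies in
  the span of the reduced rows);
* SOUNDNESS `rank_rowMatrix_of_rankRREFOK : rankRREFOK n H r piv red masks = true → (rowMatrix n H).rank = r`: the
  reduced rows are linearly independent (read off the unit pivot columns), lie in the row space, and span it; hence
  `rank = finrank (row space) = r` (type-02's `finrank_rowSpace_eq_rank`, Mathlib's `finrank_span_eq_card`);
* CONTROL (CERT-REQS A1 shape): the `[[4,2,2]]` check row `1111` has rank `1`; a `3 × 4` example with a dependent row
  has rank `2` — both by `decide` (tier KERNEL).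

Consumers: `Census/BB/BB360RankX.lean` / `BB360RankZ.lean` (`k (BB.bb360) = 12`). HONEST FRAMING: nothing here trusts
the producer of the words — the kernel recomputes every XOR and every pivot bit; the file certifies RANKS only (the
`k` of a CSS code follows by `CSSCode.k_eq`), never a distance. Elementary linear algebra ("folklore"); all proved;
axioms ⊆ {propext, Classical.choice, Quot.sound}; no `native_decide`.
-/

namespace Summit.Ventures.QEC.Census

open Matrix Literature.InformationTheory.QuantumCodes

/-! ## The certificate words -/

/-- XOR of the rows of `H` selected by the bits of `sel` (bit `i` set = row `H[i]` used). (definition) -/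
def xorMask (H : List ℕ) (sel : ℕ) : ℕ :=
  xorList ((List.range H.length).map fun i => if sel.testBit i then H.getD i 0 else 0)

/-- Re-assembly of a word from reduced rows: the XOR of the reduced rows `red[i]` whose pivot bit `piv[i]` is set in
`h`. For a word `h` in the span of reduced row-echelon rows this returns `h` itself. (definition) -/
def redSel (piv red : List ℕ) (h : ℕ) : ℕ :=
  xorList ((List.range red.length).map fun i => if h.testBit (piv.getD i 0) then red.getD i 0 else 0)

/-- **The RREF exact-rank check** for the rows `H` over `n` columns and claimed rank `r`: `|piv| = r`, unit pivot
columns (`pivotsOK`), each reduced row is the stated XOR of rows of `H`, and each row of `H` is re-assembled from the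
reduced rows by its pivot bits. Pure `List`/`Nat` recursion (`decide +kernel`). (definition) -/
def rankRREFOK (n : ℕ) (H : List ℕ) (r : ℕ) (piv red masks : List ℕ) : Bool :=
  (piv.length == r) && pivotsOK n piv red && (masks.length == red.length) &&
    ((List.range red.length).all fun i => xorMask H (masks.getD i 0) == red.getD i 0) &&
    (H.all fun h => redSel piv red h == h)

/-! ## Soundness -/

section Sound

variable {n : ℕ} {H : List ℕ} {r : ℕ} {piv red masks : List ℕ}

/-- A mask-selected XOR of rows of `H` lies in the row space of `rowMatrix n H`. [folklore] -/
theorem ofBits_xorMask_mem_rowSpace (n : ℕ) (H : List ℕ) (sel : ℕ) :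
    ofBits n (xorMask H sel) ∈ rowSpace (rowMatrix n H) := by
  rw [xorMask, ofBits_xorList, List.map_map]
  refine list_sum_mem ?_
  intro x hx
  rw [List.mem_map] at hx
  obtain ⟨i, hi, rfl⟩ := hx
  simp only [Function.comp_apply]
  split
  · have hi' : i < H.length := List.mem_range.1 hi
    have hget : H.getD i 0 = H[i] := by
      simp only [List.getD_eq_getElem?_getD, List.getElem?_eq_getElem hi', Option.getD_some]
    rw [hget]
    refine mem_rowSpace_of_vecMul_eq (Pi.single ⟨i, hi'⟩ 1) ?_
    rw [Matrix.single_one_vecMul]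
    rfl
  · rw [ofBits_zero]
    exact Submodule.zero_mem _

/-- The re-assembly `redSel piv red h` lies in the span of the reduced rows (as vectors). [folklore] -/
theorem ofBits_redSel_mem_span (n : ℕ) (piv red : List ℕ) (h : ℕ) :
    ofBits n (redSel piv red h) ∈
      Submodule.span (ZMod 2) (Set.range fun a : Fin red.length => ofBits n (red.getD a 0)) := by
  rw [redSel, ofBits_xorList, List.map_map]
  refine list_sum_mem ?_
  intro x hx
  rw [List.mem_map] at hx
  obtain ⟨i, hi, rfl⟩ := hx
  simp only [Function.comp_apply]
  split
  · exact Submodule.subset_span ⟨⟨i, List.mem_range.1 hi⟩, rfl⟩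
  · rw [ofBits_zero]
    exact Submodule.zero_mem _

/-- Unpacking `rankRREFOK`. -/
theorem rankRREFOK_spec (hc : rankRREFOK n H r piv red masks = true) :
    piv.length = r ∧ pivotsOK n piv red = true ∧ masks.length = red.length ∧
      (∀ i, i < red.length → xorMask H (masks.getD i 0) = red.getD i 0) ∧
      (∀ h ∈ H, redSel piv red h = h) := by
  simp only [rankRREFOK, Bool.and_eq_true, beq_iff_eq, List.all_eq_true, List.mem_range] at hc
  obtain ⟨⟨⟨⟨h1, h2⟩, h3⟩, h4⟩, h5⟩ := hc
  exact ⟨h1, h2, h3, h4, h5⟩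

/-- Coordinates of a word vector, as an `if`. -/
private theorem ofBits_apply_ite (w : ℕ) (q : Fin n) : ofBits n w q = if w.testBit q then 1 else 0 := rfl

/-- The reduced rows of a passing certificate are linearly independent (unit pivot columns). [folklore] -/
theorem linearIndependent_red_of_pivotsOK (hpiv : pivotsOK n piv red = true) :
    LinearIndependent (ZMod 2) (fun a : Fin red.length => ofBits n (red.getD a 0)) := by
  obtain ⟨hlen, hps⟩ := pivotsOK_spec hpiv
  rw [Fintype.linearIndependent_iff]
  intro g hg i
  have hi : (i : ℕ) < piv.length := i.2.trans_eq hlen.symm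
  have h0 := congrFun hg ⟨piv.getD i 0, (hps i hi).1⟩
  rw [Finset.sum_apply, Pi.zero_apply, Finset.sum_eq_single i] at h0
  · have hbit := testBit_red_piv hpiv hi hi
    simp only [decide_true] at hbit
    change g i * (if (red.getD i 0).testBit (piv.getD i 0) then 1 else 0) = 0 at h0
    rwa [hbit, if_pos rfl, mul_one] at h0
  · intro a _ ha
    have ha' : (a : ℕ) < piv.length := a.2.trans_eq hlen.symm
    have hne : ¬ ((a : ℕ) = (i : ℕ)) := fun e => ha (Fin.ext e)
    have hbit := testBit_red_piv hpiv hi ha'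
    simp only [hne, decide_false] at hbit
    change g a * (if (red.getD a 0).testBit (piv.getD i 0) then 1 else 0) = 0
    rw [hbit]
    simp
  · intro h
    exact absurd (Finset.mem_univ i) h

/-- **Soundness of the RREF rank certificate**: a passing check gives `rank (rowMatrix n H) = r`. The reduced rows
are independent, lie in the row space of `H` (they are XORs of its rows), and span it (every row of `H` is a XOR of
them); so the row space has dimension `|red| = |piv| = r`. [folklore] -/
theorem rank_rowMatrix_of_rankRREFOK (hc : rankRREFOK n H r piv red masks = true) :
    (rowMatrix n H).rank = r := by
  obtain ⟨hr, hpiv, -, hmask, hspan⟩ := rankRREFOK_spec hc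
  obtain ⟨hlen, -⟩ := pivotsOK_spec hpiv
  have hind := linearIndependent_red_of_pivotsOK hpiv
  have hle : Submodule.span (ZMod 2) (Set.range fun a : Fin red.length => ofBits n (red.getD a 0)) ≤
      rowSpace (rowMatrix n H) := by
    rw [Submodule.span_le]
    rintro _ ⟨a, rfl⟩
    show ofBits n (red.getD a 0) ∈ _
    rw [← hmask a a.2]
    exact ofBits_xorMask_mem_rowSpace n H _
  have hge : rowSpace (rowMatrix n H) ≤
      Submodule.span (ZMod 2) (Set.range fun a : Fin red.length => ofBits n (red.getD a 0)) := by
    intro v hv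
    obtain ⟨c, rfl⟩ := (mem_rowSpace_iff (rowMatrix n H) v).1 hv
    rw [Matrix.vecMul_eq_sum]
    refine Submodule.sum_mem _ fun i _ => Submodule.smul_mem _ _ ?_
    have hrow : (rowMatrix n H) i = ofBits n (H[(i : ℕ)]'i.2) := rfl
    rw [hrow, ← hspan _ (List.getElem_mem i.2)]
    exact ofBits_redSel_mem_span n piv red _
  rw [← finrank_rowSpace_eq_rank, le_antisymm hge hle, finrank_span_eq_card hind, Fintype.card_fin, ← hlen, hr]

end Sound

/-! ## Controls (tier KERNEL, `decide`) -/

/-- Control 1 (CERT-REQS A1 shape): the single `[[4,2,2]]` check row `1111` — rank `1` (pivot column `0`, the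
reduced row is the row itself, mask `1`). -/
theorem rankRREFOK_control422 : rankRREFOK 4 [15] 1 [0] [15] [1] = true := by decide

/-- Control 2: the rows `0011, 0110, 0101` over `4` columns (the third is the XOR of the first two) — rank `2`
with pivots `0, 1`, reduced rows `0101 = r₀ ⊕ r₁` (mask `11₂ = 3`), `0110 = r₁` (mask `2`). -/
theorem rankRREFOK_control3 : rankRREFOK 4 [3, 6, 5] 2 [0, 1] [5, 6] [3, 2] = true := by decide

/-- Control 2, read through soundness: that `3 × 4` matrix has rank `2`. -/
theorem rank_control3 : (rowMatrix 4 [3, 6, 5]).rank = 2 :=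
  rank_rowMatrix_of_rankRREFOK rankRREFOK_control3

/-- A WRONG certificate is rejected (claiming rank `3` for the same rows with a non-unit pivot column). -/
theorem rankRREFOK_control3_bad : rankRREFOK 4 [3, 6, 5] 3 [0, 1, 2] [3, 6, 5] [1, 2, 4] = false := by decide

/-! ## Linear-time forms of the certificate words (APPEND, qec-type-05 gen 4)

`xorMask` and `redSel` above index into lists with `List.getD` inside a `List.range … |>.map`, which the kernel evaluates in
QUADRATIC time (`getD i` walks `i` cells): measured ≈ 160 s per side at `n = 360` (180 rows, rank 174). The functions below
compute the same words by structural recursion on the lists (one pass each), and `rankRREFOKL` is the corresponding check;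
`rankRREFOKL_imp` transports a passing fast check to the original `rankRREFOK`, so the soundness theorem
`rank_rowMatrix_of_rankRREFOK` applies verbatim (`rank_rowMatrix_of_rankRREFOKL`). Same certificates, same data. -/

/-- `xorMask` in one pass over the rows: the mask is halved at each row. (definition) -/
def xorMaskL : List ℕ → ℕ → ℕ
  | [], _ => 0
  | h :: t, sel => (if sel.testBit 0 then h else 0) ^^^ xorMaskL t (sel / 2)

/-- `redSel` in one pass over `piv` and `red` in parallel. (definition) -/
def redSelL : List ℕ → List ℕ → ℕ → ℕ
  | p :: ps, r :: rs, h => (if h.testBit p then r else 0) ^^^ redSelL ps rs h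
  | _, _, _ => 0

/-- Every reduced row is the mask-selected XOR of rows of `H`: one pass over `red` and `masks` in parallel (equal lengths
enforced). (definition) -/
def masksOKL (H : List ℕ) : List ℕ → List ℕ → Bool
  | [], [] => true
  | r :: rs, k :: ks => (xorMaskL H k == r) && masksOKL H rs ks
  | _, _ => false

/-- **The RREF exact-rank check, linear-time form**: same four conjuncts as `rankRREFOK` with the one-pass words.
(definition) -/
def rankRREFOKL (n : ℕ) (H : List ℕ) (r : ℕ) (piv red masks : List ℕ) : Bool :=
  (piv.length == r) && pivotsOK n piv red && masksOKL H red masks && (H.all fun h => redSelL piv red h == h)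

section Linear

variable {n : ℕ} {H : List ℕ} {r : ℕ} {piv red masks : List ℕ}

/-- `xorMaskL = xorMask`. -/
theorem xorMaskL_eq (H : List ℕ) (sel : ℕ) : xorMaskL H sel = xorMask H sel := by
  induction H generalizing sel with
  | nil => rfl
  | cons h t ih =>
    have hmap : (List.range (t.length + 1)).map (fun i => if sel.testBit i then (h :: t).getD i 0 else 0)
        = (if sel.testBit 0 then h else 0) ::
            (List.range t.length).map (fun i => if (sel / 2).testBit i then t.getD i 0 else 0) := by
      rw [List.range_succ_eq_map, List.map_cons, List.map_map]
      exact congr (congrArg List.cons (by simp))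
        (List.map_congr_left fun i _ => by simp [Nat.testBit_add_one])
    rw [xorMask, List.length_cons, hmap, xorList, xorMaskL, ih (sel / 2), xorMask]

/-- `redSelL = redSel` on lists of equal length. -/
theorem redSelL_eq : ∀ (piv red : List ℕ), piv.length = red.length → ∀ h, redSelL piv red h = redSel piv red h
  | [], [], _, _ => rfl
  | [], _ :: _, hl, _ => absurd hl (by simp)
  | _ :: _, [], hl, _ => absurd hl (by simp)
  | p :: ps, q :: qs, hl, h => by
    have hmap : (List.range (qs.length + 1)).map
          (fun i => if h.testBit ((p :: ps).getD i 0) then (q :: qs).getD i 0 else 0)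
        = (if h.testBit p then q else 0) ::
            (List.range qs.length).map (fun i => if h.testBit (ps.getD i 0) then qs.getD i 0 else 0) := by
      rw [List.range_succ_eq_map, List.map_cons, List.map_map]
      exact congr (congrArg List.cons (by simp)) (List.map_congr_left fun i _ => by simp)
    rw [redSel, List.length_cons, hmap, xorList, redSelL, redSelL_eq ps qs (by simpa using hl) h, redSel]

/-- Unpacking `masksOKL`: equal lengths and every reduced row is the mask-selected XOR. -/
theorem masksOKL_spec : ∀ (red masks : List ℕ), masksOKL H red masks = true →
    masks.length = red.length ∧ ∀ i, i < red.length → xorMask H (masks.getD i 0) = red.getD i 0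
  | [], [], _ => ⟨rfl, fun i hi => absurd hi (Nat.not_lt_zero i)⟩
  | [], _ :: _, h => by simp [masksOKL] at h
  | _ :: _, [], h => by simp [masksOKL] at h
  | q :: qs, k :: ks, h => by
    simp only [masksOKL, Bool.and_eq_true, beq_iff_eq] at h
    obtain ⟨hlen, hall⟩ := masksOKL_spec qs ks h.2
    refine ⟨by simp [hlen], fun i hi => ?_⟩
    cases i with
    | zero => simpa [xorMaskL_eq] using h.1
    | succ i =>
      simp only [List.getD_cons_succ]
      exact hall i (by simpa using hi)

/-- A passing linear-time check gives a passing `rankRREFOK` (same data). -/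
theorem rankRREFOKL_imp (hc : rankRREFOKL n H r piv red masks = true) : rankRREFOK n H r piv red masks = true := by
  simp only [rankRREFOKL, Bool.and_eq_true, beq_iff_eq, List.all_eq_true] at hc
  obtain ⟨⟨⟨h1, h2⟩, h3⟩, h4⟩ := hc
  obtain ⟨hlenpr, -⟩ := pivotsOK_spec h2
  obtain ⟨hlenm, hmask⟩ := masksOKL_spec red masks h3
  simp only [rankRREFOK, Bool.and_eq_true, beq_iff_eq, List.all_eq_true, List.mem_range]
  refine ⟨⟨⟨⟨h1, h2⟩, hlenm⟩, hmask⟩, fun x hx => ?_⟩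
  rw [← redSelL_eq piv red hlenpr x]
  exact h4 x hx

/-- **Soundness, linear-time form**: a passing `rankRREFOKL` gives `rank (rowMatrix n H) = r`. [folklore] -/
theorem rank_rowMatrix_of_rankRREFOKL (hc : rankRREFOKL n H r piv red masks = true) : (rowMatrix n H).rank = r :=
  rank_rowMatrix_of_rankRREFOK (rankRREFOKL_imp hc)

end Linear

/-- Control (linear-time form): the `3 × 4` example of `rankRREFOK_control3` passes `rankRREFOKL` too. -/
theorem rankRREFOKL_control3 : rankRREFOKL 4 [3, 6, 5] 2 [0, 1] [5, 6] [3, 2] = true := by decide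

/-- … and the wrong certificate is rejected by the linear-time form as well. -/
theorem rankRREFOKL_control3_bad : rankRREFOKL 4 [3, 6, 5] 3 [0, 1, 2] [3, 6, 5] [1, 2, 4] = false := by decide

/-! ## Masks-only certificates: reduced rows derived in the kernel (APPEND 2, qec-type-05 gen 4)

At `n = 756` the reduced rows as decimal LITERALS make `pivotsOK` cost ≈ 580 s of kernel time (137 000 `testBit`s on
756-bit literal operands — the slow operand class measured by qec-search-7, 2026-08-27), whereas the SAME rows derived in
the kernel as `masks.map (xorMaskL H)` (from a kernel-built `H`, e.g. `BBRows.rowsX`) cost ≈ 140 s including their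
derivation. With derived rows the `masksOKL` conjunct holds BY CONSTRUCTION (`masksOKL_map_xorMaskL`, no evaluation), so a
certificate ships only `piv` and `masks`, and the kernel evaluates `pivotsOK` and the re-assembly conjunct
(`rank_rowMatrix_of_derived`). -/

section Derived

variable {n : ℕ} {H : List ℕ} {r : ℕ} {piv masks : List ℕ}

/-- With reduced rows DEFINED as the mask-selected XORs, the `masksOKL` conjunct holds by construction. -/
theorem masksOKL_map_xorMaskL (H : List ℕ) : ∀ masks : List ℕ, masksOKL H (masks.map (xorMaskL H)) masks = true
  | [] => rfl
  | k :: ks => by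
    rw [List.map_cons, masksOKL, Bool.and_eq_true]
    exact ⟨beq_self_eq_true _, masksOKL_map_xorMaskL H ks⟩

/-- **Soundness, masks-only form**: if the kernel-derived reduced rows `masks.map (xorMaskL H)` have unit pivot columns
(`pivotsOK`) and re-assemble every row of `H` (`redSelL`), then `rank (rowMatrix n H) = |piv|`-claimed `r`. -/
theorem rank_rowMatrix_of_derived (hr : (piv.length == r) = true)
    (hp : pivotsOK n piv (masks.map (xorMaskL H)) = true)
    (hs : (H.all fun h => redSelL piv (masks.map (xorMaskL H)) h == h) = true) :
    (rowMatrix n H).rank = r :=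
  rank_rowMatrix_of_rankRREFOKL (red := masks.map (xorMaskL H)) (masks := masks)
    (by rw [rankRREFOKL, hr, hp, masksOKL_map_xorMaskL, hs]; rfl)

end Derived

end Summit.Ventures.QEC.Census
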